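import Summits.CriticalPhenomena.PercolationContinuityZ3.Theorems.PercNearOneGluingNoHeavyLowerTailMixCSHRminusCore
import Summits.CriticalPhenomena.PercolationContinuityZ3.Theorems.PercNearOneGluingNoHeavyLowerTailCovTauStarBridge
import Summits.CriticalPhenomena.PercolationContinuityZ3.Theorems.PercNearOneGluingNoHeavyLowerTailCovTauMetaA2Anti
import HarnessLib

/-!
# KN Question 8 at `|A| = 3`, covariance side (J1): the world functionals `⟨α⟩` and `⟨h₁⟩` of the two-source induction

Support file (`--supports stmt-CriticalPhenomena-4575`, closed crux; independent mathematics on Kozma–Nitzan's Question 8 at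
`|A| = 3`), prover `prim-hp-7` (gen 39).  No named facts, no sorries; standard axioms.
Memo `prim-ineq-gen-6/FINDING-G13.md` §8(iii) and `PROOF-STAR1.md` §4–§5 (Lean plan (L3), second half): the route
`J1 ≥ 0 ⟸ (J1-A2') ⟸ (★₁) ∧ T2` through `CovTau.metaA2_abstract` with the four world functionals
`(f₁,f₂,f₃,f₄) = (⟨e⟩, ⟨h₁⟩, ⟨α⟩, ⟨A⟩)`.

SETTING: the finite-sum world framework of `CovTau` (`BHK2006.weight w` on `Set (Sym2 V)`, percolation restricted to a world
`U : Finset V`, set clusters `CovTau.sC`, worlds `CovTau.rest U N ω = U ∖ C_N`, avoidance events `BHK2006.rD`, `CovTau.avoidAll`).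
Owner `x`, observer `o`, marker `v`, the pocket-avoid set `Z` (in the memo `Z = {x,v} ∪ Y`), `Ψ` monotone nonnegative on vertex sets.
* `PcovJ1.Aw w U x o v Z N = μ_{G[U]}(v ↮ {x} ∪ N, o ∈ U, o ↮ Z ∪ N)` — the functional `⟨α⟩_N` (the pocket-avoid set GROWS with the
  source set); star decomposition `PcovJ1.Aw_step` (`CovTau.multiStep_sum`).
* `PcovJ1.Hw w x o v Z Ψ U'' = E_{G[U'']}[ Cov_{G[U'' ∖ C_o]}(Ψ(C_x), 1{x ↔ v}) ; o ∈ U'', o ↮ Z ]` — the POCKETED WORLD COVARIANCE,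
  a pure world functional; `⟨h₁⟩_N := CovTau.Yw w U x Hw N = E[Hw(U ∖ C_N); x ↮ N]`.
* `PcovJ1.H2w … N = E_{G[U]}[ Cov_{G[U ∖ C_{N ∪ {o}}]}(Ψ(C_x), 1{x↔v}) ; x ↮ N, o ∈ U, o ↮ Z ∪ N ]` — the direct form, and the
  DICTIONARY `PcovJ1.Yw_Hw_eq : Yw(Hw)(N) = H2w(N)` (domain Markov property `CovTau.sum_cond_sC` at `C_N`, then `C_{N∪{o}} = C_N ∪ C_o`).
* `PcovJ1.H2w_single_le_Hw : H2w({u}) ≤ Hw` (Markov at the pocket `C_o`, then prim-ineq-prove-1's `Y ≤ B` = `CovTauStarN.yf_le_bf`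
  in the world `U ∖ C_o`), whence `PcovJ1.Yw_Hw_antitone`: `N ↦ ⟨h₁⟩_N` is ANTITONE (`CovTau.Yw_antitone_of_le`) — hypothesis
  `hanti₂` of `CovTau.metaA2_abstract`; and the vanishing lemma `PcovJ1.Eav_eq_zero_of_obs_mem` for admissibility.
[cite: VandenbergHaggstromKahn2005, Thm. 1.1 (pp. 3–5), §1 identity (6) (p. 4), pp. 7–8] [cite: Gladkov2024, Thm. 3.2 (p. 4)]
[cite: KozmaNitzan2024, Question 8 (§5.5 p. 36)]
-/

noncomputable section

namespace Summit.CriticalPhenomena.PercolationContinuityZ3.Theorems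

namespace PcovJ1

open Literature.Probability.Percolation
open Literature.Probability.Percolation.BHK2006
open Literature.Probability.Percolation.DecisionTree (ind ind_of_mem ind_of_not_mem ind_nonneg)
open CovTau
open scoped Classical

variable {V : Type*}

/-! ### Small tools on `avoidAll` with one observer -/

/-- `avoidAll U {o} X = {o ∈ U} ∩ {o ↮ X}`. [folklore] -/
theorem mem_avoidAll_singleton {U : Finset V} {o : V} {X : Set V} {ω : Set (Sym2 V)} :
    ω ∈ avoidAll U {o} X ↔ o ∈ U ∧ ω ∈ rD U o X := by
  simp only [mem_avoidAll, Finset.mem_singleton, forall_eq]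

/-- If `o ∈ C_N` then `o` is not a vertex of the world `U ∖ C_N`, so no `avoidAll (U ∖ C_N) {o} ·` event holds. [folklore] -/
theorem not_mem_avoidAll_rest_of_mem {U : Finset V} {N : Set V} {ω : Set (Sym2 V)} {o : V} (ho : o ∈ sC U N ω)
    (X : Set V) (η : Set (Sym2 V)) : η ∉ avoidAll (rest U N ω) {o} X := fun h =>
  (mem_rest.1 (mem_avoidAll_singleton.1 h).1).2 ho

/-- If `o ∈ C_N` then `o ↔ N`, so `o ↮ Z ∪ N` fails. [folklore] -/
theorem not_mem_avoidAll_union_of_mem {U : Finset V} {N : Set V} {ω : Set (Sym2 V)} {o : V} (ho : o ∈ sC U N ω)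
    (Z : Set V) : ω ∉ avoidAll U {o} (Z ∪ N) := fun h => by
  obtain ⟨z, hz, hr⟩ := mem_sC.1 ho
  exact (mem_avoidAll_singleton.1 h).2 z (Or.inr hz) hr.symm

/-- If `o ∉ C_N`: `o ↮ Z` in the world `U ∖ C_N` iff `o ↮ Z ∪ N` in `G[U]`. [folklore] -/
theorem mem_avoidAll_rest_iff_of_not_mem {U : Finset V} {N : Set V} {ω : Set (Sym2 V)} {o : V} (ho : o ∉ sC U N ω)
    (Z : Set V) : ω ∈ avoidAll (rest U N ω) {o} Z ↔ ω ∈ avoidAll U {o} (Z ∪ N) := by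
  rw [mem_avoidAll_singleton, mem_avoidAll_singleton, mem_rest, rD_union]
  have hN : ω ∈ rD U o N := (not_mem_sC_iff U N ω o).1 ho
  simp only [rD, Set.mem_setOf_eq, Set.mem_inter_iff, reach_rest_iff ho]
  exact ⟨fun h => ⟨h.1.1, h.2, hN⟩, fun h => ⟨⟨h.1, ho⟩, h.2.1⟩⟩

variable [Fintype V]

/-! ### `⟨α⟩`: both small clusters avoid the sources, the pocket also avoids `Z` -/

/-- `⟨α⟩_N = μ_{G[U]}(v ↮ {x} ∪ N, o ∈ U, o ↮ Z ∪ N)` (FINDING-G13 §8(iii): the pocket-avoid set grows with the source set).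
[cite: KozmaNitzan2024, Question 8 (§5.5 p. 36)] [cite: VandenbergHaggstromKahn2005, §1 p. 3] -/
def Aw (w : Sym2 V → ℝ) (U : Finset V) (x o v : V) (Z : Set V) (N : Set V) : ℝ :=
  ∑ ω, weight w ω * (ind (rD U v ({x} ∪ N)) ω * ind (avoidAll U {o} (Z ∪ N)) ω)

/-- `⟨α⟩_N ≥ 0`. [folklore] -/
theorem Aw_nonneg {w : Sym2 V → ℝ} (hw0 : ∀ e, 0 ≤ w e) (hw1 : ∀ e, w e ≤ 1) (U : Finset V) (x o v : V)
    (Z N : Set V) : 0 ≤ Aw w U x o v Z N :=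
  Finset.sum_nonneg fun ω _ => mul_nonneg (weight_nonneg hw0 hw1 ω) (mul_nonneg (ind_nonneg _ _) (ind_nonneg _ _))

/-- **Star decomposition of `⟨α⟩`** (BHK's identity (6), `CovTau.multiStep_sum`): for `Z' ⊆ N`, `v ∉ Z'`,
`⟨α⟩^U_N = Σ_ω weight(ω) · ⟨α⟩^{U∖Z'}_{(N∖Z') ∪ S(ω)}`. [cite: VandenbergHaggstromKahn2005, §1 p. 4, identity (6)] -/
theorem Aw_step {U Z' : Finset V} (hZU : Z' ⊆ U) {v : V} (hvU : v ∈ U) (hv : v ∉ Z') {N : Set V}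
    (hZN : (↑Z' : Set V) ⊆ N) (w : Sym2 V → ℝ) (hm : ∑ ω, weight w ω = 1) (x o : V) (Z : Set V) :
    Aw w U x o v Z N = ∑ ω, weight w ω * Aw w (U \ Z') x o v Z ((N \ ↑Z') ∪ rS U Z' ω) := by
  have hZW : (↑Z' : Set V) ⊆ {x} ∪ N := hZN.trans Set.subset_union_right
  have hZW' : (↑Z' : Set V) ⊆ Z ∪ N := hZN.trans Set.subset_union_right
  have hvUZ : v ∈ U \ Z' := Finset.mem_sdiff.2 ⟨hvU, hv⟩
  have h := multiStep_sum hZU hv hZW {o} hZW' w hm (fun _ => (1 : ℝ))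
  simp only [one_mul] at h
  unfold Aw
  rw [h]
  refine Finset.sum_congr rfl fun ω _ => ?_
  congr 1
  refine Finset.sum_congr rfl fun ω' _ => ?_
  rw [rD_eq_of_agree (U \ Z') hvUZ (union_diff_agree U Z' {x} N (rS U Z' ω)),
    avoidAll_eq_of_agree (U \ Z') {o} (union_diff_agree U Z' Z N (rS U Z' ω))]

/-- `⟨e⟩ = 0` when the observer is a source (`o ∈ C_v` and `v ↮ A ∪ N ∋ o` are incompatible). [folklore] -/
theorem Eav_eq_zero_of_obs_mem (w : Sym2 V → ℝ) (U : Finset V) (A : Set V) (o v : V) {N : Set V}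
    (ho : o ∈ A ∪ N) : Eav w U A o v N = 0 :=
  Finset.sum_eq_zero fun ω _ => by
    by_cases h : ω ∈ rD U v (A ∪ N)
    · have : oInd o v (rC U v ω) = 0 := by
        rw [oInd_rC]; exact ind_of_not_mem fun hr => h o ho hr
      rw [this]; ring
    · rw [ind_of_not_mem h]; ring

/-- `⟨e⟩ = 0` in a world not containing `v` (for `o ≠ v`): `C_v` has no edge, so `o ∉ C_v`. [folklore] -/
theorem Eav_eq_zero_of_not_mem (w : Sym2 V → ℝ) {U : Finset V} (A : Set V) {o v : V} (hov : o ≠ v) (hvU : v ∉ U)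
    (N : Set V) : Eav w U A o v N = 0 :=
  Finset.sum_eq_zero fun ω _ => by
    have : oInd o v (rC U v ω) = 0 := by
      rw [oInd_rC]
      exact ind_of_not_mem fun hr => hvU (SandwichBHK.mem_of_reachable (SimpleGraph.Reachable.symm hr) hov)
    rw [this]; ring

/-! ### The pocketed world covariance `Hw` and `⟨h₁⟩ = Yw ∘ Hw` -/

/-- **Pocketed world covariance** `Hw(U'') = E_{G[U'']}[ Cov_{G[U''∖C_o]}(Ψ(C_x), 1{x↔v}) ; o ∈ U'', o ↮ Z ]` — a pure world
functional (FINDING-G13 §8: `h₁(W) = Σ_P μ_Γ(C_o = P, P ∩ Z = ∅)·H(W ∪ P)`). [cite: KozmaNitzan2024, Question 8 (§5.5 p. 36)] -/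
def Hw (w : Sym2 V → ℝ) (x o v : V) (Z : Set V) (Ψ : Set V → ℝ) (U : Finset V) : ℝ :=
  ∑ ω, weight w ω * (Bf w (rest U ({o} : Set V) ω) x v Ψ * ind (avoidAll U {o} Z) ω)

/-- **Direct form** `H2w(N) = E_{G[U]}[ Cov_{G[U ∖ C_{N∪{o}}]}(Ψ(C_x), 1{x↔v}) ; x ↮ N, o ∈ U, o ↮ Z ∪ N ]`.
[cite: KozmaNitzan2024, Question 8 (§5.5 p. 36)] -/
def H2w (w : Sym2 V → ℝ) (U : Finset V) (x o v : V) (Z : Set V) (Ψ : Set V → ℝ) (N : Set V) : ℝ :=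
  ∑ ω, weight w ω * (Bf w (rest U (insert o N) ω) x v Ψ * (ind (rD U x N) ω * ind (avoidAll U {o} (Z ∪ N)) ω))

section Props

variable {w : Sym2 V → ℝ} (hw0 : ∀ e, 0 ≤ w e) (hw1 : ∀ e, w e ≤ 1) (hm : ∑ ω, weight w ω = 1)
include hw0 hw1 hm

/-- `Hw ≥ 0` (Harris in each world). [cite: VandenbergHaggstromKahn2005, §1 p. 6] -/
theorem Hw_nonneg (x o v : V) (Z : Set V) {Ψ : Set V → ℝ} (hΨ : ∀ S T : Set V, S ⊆ T → Ψ S ≤ Ψ T)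
    (hΨ0 : ∀ S, 0 ≤ Ψ S) (U : Finset V) : 0 ≤ Hw w x o v Z Ψ U :=
  sum_ind_nonneg hw0 hw1 (fun _ => Bf_nonneg hw0 hw1 hm _ x v hΨ hΨ0) _

/-- `H2w ≥ 0`. [cite: VandenbergHaggstromKahn2005, §1 p. 6] -/
theorem H2w_nonneg (U : Finset V) (x o v : V) (Z : Set V) {Ψ : Set V → ℝ} (hΨ : ∀ S T : Set V, S ⊆ T → Ψ S ≤ Ψ T)
    (hΨ0 : ∀ S, 0 ≤ Ψ S) (N : Set V) : 0 ≤ H2w w U x o v Z Ψ N :=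
  Finset.sum_nonneg fun ω _ => mul_nonneg (weight_nonneg hw0 hw1 ω)
    (mul_nonneg (Bf_nonneg hw0 hw1 hm _ x v hΨ hΨ0) (mul_nonneg (ind_nonneg _ _) (ind_nonneg _ _)))

end Props

/-- `Hw(U'') = 0` when `v ∉ U''` (for `v ≠ x`): no sub-world contains `v`. [folklore] -/
theorem Hw_eq_zero_of_not_mem (w : Sym2 V → ℝ) {x o v : V} (hvx : v ≠ x) (Z : Set V) (Ψ : Set V → ℝ) {U : Finset V}
    (hv : v ∉ U) : Hw w x o v Z Ψ U = 0 :=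
  Finset.sum_eq_zero fun ω _ => by
    rw [Bf_eq_zero_of_not_mem w (fun h' => hv (rest_subset U _ ω h')) hvx]; ring

/-- **Dictionary `⟨h₁⟩_N = Yw(Hw)(N) = H2w(N)`**: condition on the value of `C_N` (`CovTau.sum_cond_sC`); given `C_N ∌ o`,
`U ∖ C_N ∖ C^{U∖C_N}_o = U ∖ C_{N ∪ {o}}` and `o ↮ Z` in `U ∖ C_N` iff `o ↮ Z ∪ N` in `U`.
[cite: VandenbergHaggstromKahn2005, §1 pp. 7–8, display (10)] -/
theorem Yw_Hw_eq (w : Sym2 V → ℝ) (hm : ∑ ω, weight w ω = 1) (U : Finset V) (x o v : V) (Z : Set V)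
    (Ψ : Set V → ℝ) (N : Set V) : Yw w U x (Hw w x o v Z Ψ) N = H2w w U x o v Z Ψ N := by
  set Φ : Set V → Set (Sym2 V) → ℝ := fun W η =>
    ind {W : Set V | x ∉ W} W * (Bf w (rest (U.filter fun a => a ∉ W) ({o} : Set V) η) x v Ψ *
      ind (avoidAll (U.filter fun a => a ∉ W) {o} Z) η) with hΦ
  have h1 : Yw w U x (Hw w x o v Z Ψ) N =
      ∑ ω, weight w ω * ∑ ω', weight w ω' * Φ (sC U N ω) (ω' ∩ edgesIn (rest U N ω)) := by
    unfold Yw Hw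
    refine Finset.sum_congr rfl fun ω _ => ?_
    rw [← ind_not_mem_sC_eq U x N ω, mul_comm (∑ ω', _) _, Finset.mul_sum]
    congr 1
    refine Finset.sum_congr rfl fun ω' _ => ?_
    simp only [hΦ, ← rest_eq_filter, rest_inter_edgesIn, ind_avoidAll_inter_edgesIn]
    ring
  rw [h1, ← sum_cond_sC w hm U N Φ]
  unfold H2w
  refine Finset.sum_congr rfl fun ω _ => ?_
  congr 1
  simp only [hΦ, ← rest_eq_filter, rest_inter_edgesIn, ind_avoidAll_inter_edgesIn, ind_not_mem_sC_eq]
  by_cases ho : o ∈ sC U N ω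
  · rw [ind_of_not_mem (not_mem_avoidAll_rest_of_mem ho Z ω), ind_of_not_mem (not_mem_avoidAll_union_of_mem ho Z)]
    ring
  · rw [rest_insert_of_not_mem ho, BystanderBHK.ind_congr (mem_avoidAll_rest_iff_of_not_mem ho Z)]
    ring

omit [Fintype V] in
/-- `o ∈ U ∧ o ↮ Z` as an indicator of the pocket value `C_o`. [folklore] -/
theorem ind_avoidAll_eq_ind_sC (U : Finset V) (o : V) (Z : Set V) (ω : Set (Sym2 V)) :
    ind (avoidAll U {o} Z) ω = ind {P : Set V | o ∈ U ∧ ∀ z ∈ Z, z ∉ P} (sC U ({o} : Set V) ω) := by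
  refine BystanderBHK.ind_congr ?_
  simp only [mem_avoidAll_singleton, rD, Set.mem_setOf_eq, mem_sC_singleton]

/-- **One-source bound `H2w({u}) ≤ Hw`** (hypothesis `hYB` of `CovTau.Yw_antitone_of_le` for `F = Hw`): condition on the pocket
`C_o` (`CovTau.sum_cond_sC`); in the world `U ∖ C_o` the claim is `Y({u}) ≤ B` (`CovTauStarN.yf_le_bf`, decision-tree Harris).
[cite: Gladkov2024, Thm. 3.2 (p. 4)] [cite: VandenbergHaggstromKahn2005, §1 pp. 7–8] -/
theorem H2w_single_le_Hw (w : Sym2 V → ℝ) (hw0 : ∀ e, 0 ≤ w e) (hw1 : ∀ e, w e ≤ 1)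
    (hm : ∑ ω, weight w ω = 1) (U : Finset V) (x o v : V) (Z : Set V) {Ψ : Set V → ℝ}
    (hΨ : ∀ S T : Set V, S ⊆ T → Ψ S ≤ Ψ T) (hΨ0 : ∀ S, 0 ≤ Ψ S) (u : V) :
    H2w w U x o v Z Ψ {u} ≤ Hw w x o v Z Ψ U := by
  set Φ : Set V → Set (Sym2 V) → ℝ := fun P η =>
    ind {P : Set V | o ∈ U ∧ ∀ z ∈ Z, z ∉ P} P *
      (Bf w (rest (U.filter fun a => a ∉ P) ({u} : Set V) η) x v Ψ *
        ind (rD (U.filter fun a => a ∉ P) x ({u} : Set V)) η) with hΦ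
  -- (1) `Hw ≥ Σ weight · 1{o ∈ U, o ↮ Z} · Y_{U∖C_o}({u})`, and the latter through the Markov property
  have hYB : ∑ ω, weight w ω * (ind (avoidAll U {o} Z) ω * Yf w (rest U ({o} : Set V) ω) x v Ψ {u}) ≤
      Hw w x o v Z Ψ U := by
    unfold Hw
    refine Finset.sum_le_sum fun ω _ => mul_le_mul_of_nonneg_left ?_ (weight_nonneg hw0 hw1 ω)
    rw [mul_comm (Bf w _ x v Ψ)]
    exact mul_le_mul_of_nonneg_left (CovTauStarN.yf_le_bf w hw0 hw1 x v hΨ hΨ0 _ _) (ind_nonneg _ _)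
  have hmark : ∑ ω, weight w ω * (ind (avoidAll U {o} Z) ω * Yf w (rest U ({o} : Set V) ω) x v Ψ {u}) =
      ∑ ω, weight w ω * Φ (sC U ({o} : Set V) ω) (ω ∩ edgesIn (rest U ({o} : Set V) ω)) := by
    rw [sum_cond_sC w hm U ({o} : Set V) Φ]
    refine Finset.sum_congr rfl fun ω _ => ?_
    congr 1
    unfold Yf
    rw [ind_avoidAll_eq_ind_sC, Finset.mul_sum]
    refine Finset.sum_congr rfl fun ω' _ => ?_
    simp only [hΦ, ← rest_eq_filter, rest_inter_edgesIn, BystanderBHK.ind_congr (mem_rD_inter_edgesIn _ _ _ _)]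
    ring
  refine le_trans ?_ (le_trans (le_of_eq hmark.symm) hYB)
  -- (2) pointwise comparison of `H2w({u})` with the Markov form
  unfold H2w
  refine Finset.sum_le_sum fun ω _ => mul_le_mul_of_nonneg_left ?_ (weight_nonneg hw0 hw1 ω)
  simp only [hΦ, ← rest_eq_filter, rest_inter_edgesIn, BystanderBHK.ind_congr (mem_rD_inter_edgesIn _ _ _ _),
    ← ind_avoidAll_eq_ind_sC]
  by_cases hu : u ∈ sC U ({o} : Set V) ω
  · -- `o ↔ u`: the left integrand vanishes
    have h0 : ω ∉ avoidAll U {o} (Z ∪ {u}) := fun h =>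
      (mem_avoidAll_singleton.1 h).2 u (Or.inr rfl) (mem_sC_singleton.1 hu)
    rw [ind_of_not_mem h0, mul_zero, mul_zero]
    exact mul_nonneg (ind_nonneg _ _) (mul_nonneg (Bf_nonneg hw0 hw1 hm _ x v hΨ hΨ0) (ind_nonneg _ _))
  · -- `o ↮ u`: the two integrands agree
    have hw' : rest U (insert o ({u} : Set V)) ω = rest (rest U ({o} : Set V) ω) ({u} : Set V) ω := by
      rw [show (insert o ({u} : Set V)) = insert u ({o} : Set V) from Set.pair_comm o u, rest_insert_of_not_mem hu]
    have hx : ind (rD (rest U ({o} : Set V) ω) x ({u} : Set V)) ω = ind (rD U x ({u} : Set V)) ω := by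
      refine BystanderBHK.ind_congr ?_
      simp only [rD, Set.mem_setOf_eq, Set.mem_singleton_iff, forall_eq]
      rw [SimpleGraph.reachable_comm, reach_rest_iff hu, SimpleGraph.reachable_comm]
    have ha : ind (avoidAll U {o} (Z ∪ {u})) ω = ind (avoidAll U {o} Z) ω := by
      refine BystanderBHK.ind_congr ?_
      rw [mem_avoidAll_singleton, mem_avoidAll_singleton, rD_union]
      simp only [Set.mem_inter_iff]
      have : ω ∈ rD U o ({u} : Set V) := fun a ha hr => hu (mem_sC_singleton.2 (by
        rw [Set.mem_singleton_iff] at ha; exact ha ▸ hr))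
      tauto
    rw [hw', hx, ha]
    exact le_of_eq (by ring)

/-- **`⟨h₁⟩` is antitone in the source set**: `N ⊆ N' ⊆ U ⟹ Yw(Hw)(N') ≤ Yw(Hw)(N)` (hypothesis `hanti₂` of
`CovTau.metaA2_abstract`; FINDING-G13 §8(iii) "⟨h₁⟩ antitone"). [cite: VandenbergHaggstromKahn2005, §1 pp. 7–8]
[cite: Gladkov2024, Thm. 3.2 (p. 4)] -/
theorem Yw_Hw_antitone (w : Sym2 V → ℝ) (hw0 : ∀ e, 0 ≤ w e) (hw1 : ∀ e, w e ≤ 1)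
    (hm : ∑ ω, weight w ω = 1) (U : Finset V) (x o v : V) (Z : Set V) {Ψ : Set V → ℝ}
    (hΨ : ∀ S T : Set V, S ⊆ T → Ψ S ≤ Ψ T) (hΨ0 : ∀ S, 0 ≤ Ψ S) {N N' : Set V} (hNN' : N ⊆ N')
    (hN'U : N' ⊆ ↑U) : Yw w U x (Hw w x o v Z Ψ) N' ≤ Yw w U x (Hw w x o v Z Ψ) N :=
  Yw_antitone_of_le w hw0 hw1 hm x (Hw w x o v Z Ψ) U
    (fun U' _ u => by rw [Yw_Hw_eq w hm]; exact H2w_single_le_Hw w hw0 hw1 hm U' x o v Z hΨ hΨ0 u) hNN' hN'U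

end PcovJ1

end Summit.CriticalPhenomena.PercolationContinuityZ3.Theorems

end
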